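import Mathlib
import Literature.Probability.RandomPlanarGeometry.ConformalRemovability
import Literature.Probability.RandomPlanarGeometry.CurveSpace
import HarnessLib

/-!
# Non-removability of the trace is an analytic condition (stub T2c of crux `RemovableLimit`)

Route `SAWWeldingIdentification`, crux stmt-CriticalPhenomena-4503 `RemovableLimit`, line
`registered` (skeleton v3), stub `stub_analyticSet_not_removable_of_measurable`.
-/

open MeasureTheory Filter Set Topology
open Literature.Probability.RandomPlanarGeometry

namespace Summit.CriticalPhenomena.SAWScalingLimit.Theorems.RemovableLimit

/-- Pointwise formula for the extension by zero of a function on `Ω`: on `Ω` it is the function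
itself (`Function.Injective.extend_apply` for `Subtype.val`). [folklore] -/
theorem extend_subtypeVal_apply_of_mem {Ω : Set ℂ} (g : Ω → ℂ) {z : ℂ} (hz : z ∈ Ω) :
    Function.extend Subtype.val g 0 z = g ⟨z, hz⟩ :=
  Subtype.val_injective.extend_apply g 0 ⟨z, hz⟩

/-- **Non-removability is an analytic condition on the trace, given the Borel bookkeeping.** For
open `Ω ⊆ ℂ`: if "`ĝ` holomorphic on `Ω ∖ γ.range`" is Borel in `(γ, g) ∈ CurveClass ℂ × C(Ω, ℂ)`,
"`ĝ` holomorphic on `Ω`" and "`g` injective" are Borel in `g` (Borel σ-algebra of the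
compact-open topology; `ĝ = Function.extend Subtype.val g 0`), then
`{γ : CurveClass ℂ | ¬ IsConformallyRemovableIn Ω γ.range}` is an analytic set: the first
projection of the Borel set `{(γ, g) | g injective ∧ ĝ holomorphic on Ω ∖ γ.range ∧ ¬ ĝ
holomorphic on Ω}` of the Polish space `CurveClass ℂ × C(Ω, ℂ)`. [folklore] -/
theorem stub_analyticSet_not_removable_of_measurable {Ω : Set ℂ} (hΩ : IsOpen Ω)
    (hD : ∀ [MeasurableSpace C(Ω, ℂ)] [BorelSpace C(Ω, ℂ)],
      MeasurableSet {p : CurveClass ℂ × C(Ω, ℂ) |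
          DifferentiableOn ℂ (Function.extend Subtype.val (⇑p.2) 0) (Ω \ p.1.range)} ∧
        MeasurableSet {g : C(Ω, ℂ) | DifferentiableOn ℂ (Function.extend Subtype.val (⇑g) 0) Ω})
    (hI : ∀ [MeasurableSpace C(Ω, ℂ)] [BorelSpace C(Ω, ℂ)],
      MeasurableSet {g : C(Ω, ℂ) | Function.Injective g}) :
    AnalyticSet {γ : CurveClass ℂ | ¬ IsConformallyRemovableIn Ω γ.range} := by
  haveI : LocallyCompactSpace Ω := hΩ.locallyCompactSpace
  letI : MeasurableSpace C(Ω, ℂ) := borel _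
  haveI : BorelSpace C(Ω, ℂ) := ⟨rfl⟩
  obtain ⟨hD1, hD2⟩ := hD
  -- the Borel set of witnesses `(γ, g)`: `g` injective, `ĝ` holomorphic off the trace, not on `Ω`
  set B : Set (CurveClass ℂ × C(Ω, ℂ)) := {p | Function.Injective p.2 ∧
      DifferentiableOn ℂ (Function.extend Subtype.val (⇑p.2) 0) (Ω \ p.1.range) ∧
      ¬ DifferentiableOn ℂ (Function.extend Subtype.val (⇑p.2) 0) Ω}
  have hB : MeasurableSet B :=
    (hI.preimage measurable_snd).inter (hD1.inter (hD2.preimage measurable_snd).compl)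
  have key : {γ : CurveClass ℂ | ¬ IsConformallyRemovableIn Ω γ.range} = Prod.fst '' B := by
    ext γ
    constructor
    · intro hγ
      simp only [mem_setOf_eq, IsConformallyRemovableIn] at hγ
      push Not at hγ
      obtain ⟨F, hFc, hFi, hFd, hFn⟩ := hγ
      -- the witness: the restriction of `F` to `Ω`, a continuous map on the subtype
      set g : C(Ω, ℂ) := ⟨Ω.restrict F, hFc.restrict⟩
      have heq : EqOn (Function.extend Subtype.val (⇑g) 0) F Ω := fun z hz =>
        extend_subtypeVal_apply_of_mem (⇑g) hz
      refine ⟨(γ, g), ⟨?_, hFd.congr fun z hz => heq hz.1, fun h => hFn (h.congr fun z hz =>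
        (heq hz).symm)⟩, rfl⟩
      intro a b hab
      exact Subtype.ext (hFi a.2 b.2 hab)
    · rintro ⟨⟨γ', g⟩, ⟨hinj, hd, hn⟩, rfl⟩ hrem
      refine hn (hrem _ ?_ ?_ hd)
      · rw [continuousOn_iff_continuous_restrict, restrict_eq,
          Function.extend_comp Subtype.val_injective]
        exact g.continuous
      · intro a ha b hb hab
        rw [extend_subtypeVal_apply_of_mem (⇑g) ha, extend_subtypeVal_apply_of_mem (⇑g) hb] at hab
        exact congrArg Subtype.val (hinj hab)
  rw [key]
  exact hB.analyticSet_image measurable_fst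

end Summit.CriticalPhenomena.SAWScalingLimit.Theorems.RemovableLimit
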